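import Summits.CriticalPhenomena.PercolationContinuityZ3.Theorems.PercNearOneGluingNoHeavyLowerTailSahiTripartitionUnionConditioned
import Summits.CriticalPhenomena.PercolationContinuityZ3.Theorems.PercNearOneGluingNoHeavyLowerTailSahiTripartitionULC
import Mathlib
import HarnessLib
import HarnessLib.Audit.Tags

/-!
# `NoHeavyLowerTail` (crux stmt-CriticalPhenomena-4575), master-family line P1 (gen 18):
# the twist dictionary (two-covers of `t` ↔ ordered tripartitions read through `· △ t`) and the degree-1 member for UNATE properties

Support file (seat `prim-masterthm-p1`, gen 18; `--supports stmt-CriticalPhenomena-4575`), on top of `…SahiTripartitionUnionConditioned`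
(gen 18: `pairCount`, `twoCover`, `twoCover_and_mul_le`) and `…SahiTripartitionULC` (gen 17: `triCount`, `triCount_and_mul_le` for MONOTONE `u`,
typed `UnateTripartitionULC` for UNATE `u`).  Memo `run/shared/lean/prim/prim-masterthm/FROM-prim-masterthm-p1-g18-UNION-CONDITIONED.md` §1.
* `twistEquiv t` (the involution `x ↦ x △ t`), `twoCover_twist`: `twoCover t (x △ t) (y △ t) ↔ Disjoint x y` — the pairs of cells of an
  ordered tripartition, read through the twist, are exactly the two-covers of `t`;
* `triCount_eq_sum_disjoint`, **`pairCount_twoCover_twist`**: `pairCount (twoCover t) (P ∘ (u ∘ (· △ t))) = triCount u P` for every pattern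
  `P` of the first two cells;
* **THEOREM `triCount_and_mul_le_of_unate`**: for `u` with `Monotone (fun x => u (x △ t))` (the hypothesis of `UnateTripartitionULC`),
  `#{X ∈ u ∧ Y ∈ u}·#{all} ≤ #{X ∈ u}·#{Y ∈ u}` over ordered tripartitions — the degree-1 member `M₁² ≥ M₀M₂` of the ULC chain for
  every UNATE property (the tree had it for monotone `u`); from `twoCover_and_mul_le` (four functions) via the dictionary.
HONEST FRAMING: a bookkeeping file (one bijection) upgrading a kernel theorem from monotone to unate; the degree-2 members (the lemma) remain OPEN.
[this work]
-/

namespace Summit.CriticalPhenomena.PercolationContinuityZ3.Theorems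

namespace SahiTripartition

open Finset

variable {ι : Type*} [Fintype ι] [DecidableEq ι]

/-! ### The twist dictionary and the degree-1 member for unate properties -/

/-- The twist `x ↦ x ∆ t` as a permutation of `Finset ι` (an involution). [this work] -/
def twistEquiv (t : Finset ι) : Finset ι ≃ Finset ι where
  toFun x := symmDiff x t
  invFun x := symmDiff x t
  left_inv x := symmDiff_symmDiff_cancel_right t x
  right_inv x := symmDiff_symmDiff_cancel_right t x

omit [Fintype ι] in
/-- Twisting both cells by `t` turns disjoint pairs into two-covers of `t` and back. [this work] -/
theorem twoCover_twist (t x y : Finset ι) :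
    twoCover t (symmDiff x t) (symmDiff y t) = decide (Disjoint x y) := by
  simp only [twoCover]
  apply decide_eq_decide.mpr
  rw [disjoint_left]
  constructor
  · rintro ⟨h1, h2⟩ a hax hay
    by_cases hat : a ∈ t
    · have h := h2 hat
      rw [mem_union, mem_symmDiff, mem_symmDiff] at h
      rcases h with (⟨_, h⟩ | ⟨_, h⟩) | (⟨_, h⟩ | ⟨_, h⟩)
      · exact h hat
      · exact h hax
      · exact h hat
      · exact h hay
    · have : a ∈ symmDiff x t ∩ symmDiff y t := by
        rw [mem_inter, mem_symmDiff, mem_symmDiff]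
        exact ⟨Or.inl ⟨hax, hat⟩, Or.inl ⟨hay, hat⟩⟩
      exact hat (h1 this)
  · intro h
    constructor
    · intro a ha
      rw [mem_inter, mem_symmDiff, mem_symmDiff] at ha
      obtain ⟨h1, h2⟩ := ha
      rcases h1 with ⟨hax, hat⟩ | ⟨hat, _⟩
      · rcases h2 with ⟨hay, _⟩ | ⟨hat', _⟩
        · exact absurd hay (h hax)
        · exact hat'
      · exact hat
    · intro a hat
      rw [mem_union, mem_symmDiff, mem_symmDiff]
      by_cases hax : a ∈ x
      · exact Or.inr (Or.inr ⟨hat, h hax⟩)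
      · exact Or.inl (Or.inr ⟨hat, hax⟩)

/-- The tree's pattern count, for patterns of the first two cells, as a double sum over disjoint pairs. [this work] -/
theorem triCount_eq_sum_disjoint (u : Finset ι → Bool) (P : Bool → Bool → Bool) :
    triCount u (fun a b _ => P a b) =
      ∑ x : Finset ι, ∑ y : Finset ι, if Disjoint x y ∧ P (u x) (u y) = true then 1 else 0 := by
  unfold triCount
  refine Fintype.sum_congr _ _ fun x => ?_
  rw [card_filter]
  have hp : xᶜ.powerset = (univ : Finset (Finset ι)).filter (fun y => Disjoint x y) := by
    ext y
    rw [mem_powerset, mem_filter, subset_compl_iff_disjoint_left]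
    simp
  rw [hp, sum_filter]
  refine Fintype.sum_congr _ _ fun y => ?_
  by_cases hd : Disjoint x y <;> by_cases hq : P (u x) (u y) = true <;> simp [hd, hq]

/-- **Dictionary.**  Counting two-covers of `t` whose (untwisted) cells show a pattern = the tree's `triCount` of the unate property `u`
for that pattern. [this work] -/
theorem pairCount_twoCover_twist (t : Finset ι) (u : Finset ι → Bool) (P : Bool → Bool → Bool) :
    pairCount (twoCover t) (fun x y => P (u (symmDiff x t)) (u (symmDiff y t))) = triCount u (fun a b _ => P a b) := by
  rw [triCount_eq_sum_disjoint]
  unfold pairCount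
  rw [← (twistEquiv t).sum_comp]
  refine Fintype.sum_congr _ _ fun x => ?_
  rw [← (twistEquiv t).sum_comp]
  refine Fintype.sum_congr _ _ fun y => ?_
  show (if twoCover t (symmDiff x t) (symmDiff y t) = true ∧
      P (u (symmDiff (symmDiff x t) t)) (u (symmDiff (symmDiff y t) t)) = true then 1 else 0) = _
  rw [twoCover_twist, symmDiff_symmDiff_cancel_right, symmDiff_symmDiff_cancel_right]
  simp only [decide_eq_true_eq]

/-- **Degree-1 member for UNATE properties, in the tree's vocabulary.**  For `u` unate (monotone after the twist `t`, as in the typed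
conjecture `UnateTripartitionULC`): `#{X ∈ u ∧ Y ∈ u}·#{all} ≤ #{X ∈ u}·#{Y ∈ u}` over ordered tripartitions — the tree's
`triCount_and_mul_le` had this for monotone `u` only. [this work] -/
theorem triCount_and_mul_le_of_unate (u : Finset ι → Bool) (t : Finset ι)
    (hu : Monotone (fun x => u (symmDiff x t))) :
    triCount u (fun a b _ => a && b) * triCount u (fun _ _ _ => true) ≤
      triCount u (fun a _ _ => a) * triCount u (fun _ b _ => b) := by
  have h := twoCover_and_mul_le t (fun x => u (symmDiff x t)) (fun x => u (symmDiff x t)) hu hu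
  have e1 := pairCount_twoCover_twist t u (fun a b => a && b)
  have e2 := pairCount_twoCover_twist t u (fun _ _ => true)
  have e3 := pairCount_twoCover_twist t u (fun a _ => a)
  have e4 := pairCount_twoCover_twist t u (fun _ b => b)
  rw [e1, e2, e3, e4] at h
  exact h

end SahiTripartition

end Summit.CriticalPhenomena.PercolationContinuityZ3.Theorems
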